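import Literature.Analysis.Calculus.CkArzelaAscoli
import Literature.Analysis.FunctionSpaces.DiagonalSubsequence
import HarnessLib

/-!
# The `C^∞` Arzelà–Ascoli theorem: sequences bounded in every `Cᵏ` have `C^∞_loc`-convergent subsequences
(topic `Analysis/Calculus`; the compact embedding `C^∞ ↪ C^∞` on open sets in sequential form —
Cantor's diagonal procedure over the `Cᵏ` Arzelà–Ascoli theorems `CkArzelaAscoli.lean`;
Petersen 2006, Ch. 10, §3.1, the analytic half of Cheeger–Gromov compactness at all orders)

**Theorem (`exists_strictMono_contDiffOn_infty_tendstoUniformlyOn_iteratedFDeriv`).** Let `E, F`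
be finite-dimensional real normed spaces, `U ⊆ E` open, and `f : ℕ → E → F` maps smooth on `U`
such that for EVERY order `i` and every compact `K ⊆ U` there is a common bound
`‖Dⁱ fₙ(x)‖ ≤ Λ_{i,K}` (`n ∈ ℕ`, `x ∈ K`). Then there are a strictly increasing `φ : ℕ → ℕ` and a
map `g` smooth on `U` such that for every `i` the derivatives `Dⁱ f_{φ n}` converge to `Dⁱ g`
uniformly on every compact subset of `U` (equivalently, locally uniformly on `U`).

Proof. For each `k`, every subsequence has a further subsequence converging in `Cᵏ` on compacts
to a `Cᵏ` map (`CkArzelaAscoli.lean`); the property "converges in `Cᵏ` on compacts to some `Cᵏ`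
map" passes to eventual further subsequences, so Cantor's diagonal extraction
(`DiagonalSubsequence.lean`) yields ONE `φ` with this property for every `k`, with limits `g_k`.
The `g_k` agree on `U` (they are pointwise limits of the same sequence), so `g := g_0` is `Cᵏ` on
`U` for every `k`, i.e. smooth, and `Dⁱ g = Dⁱ g_i` on the open set `U`.

## References
* [Petersen2006] P. Petersen, *Riemannian Geometry*, 2nd ed., GTM 171, Springer 2006, Ch. 10, §3.1.
* [Seregin2014] G. Seregin, *Lecture notes on regularity theory for the Navier–Stokes equations*,
  World Scientific 2014, App. B §B.4 (the diagonal procedure).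
-/

noncomputable section

open Set Metric Filter Topology Function
open scoped ContDiff Topology

namespace Literature.Analysis.Calculus

open Literature.Analysis.FunctionSpaces

/-- Uniform convergence along a subsequence passes to eventual further subsequences. [folklore] -/
theorem tendstoUniformlyOn_of_eventually_eq_comp {X Y : Type*} [UniformSpace Y] {G : ℕ → X → Y}
    {g : X → Y} {K : Set X} {φ φ' ρ : ℕ → ℕ} (hρ : StrictMono ρ)
    (heq : ∀ᶠ k in atTop, φ' k = φ (ρ k)) (h : TendstoUniformlyOn (fun n ↦ G (φ n)) g atTop K) :
    TendstoUniformlyOn (fun n ↦ G (φ' n)) g atTop K := by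
  intro u hu
  have h1 : ∀ᶠ n in atTop, ∀ x ∈ K, (g x, G (φ (ρ n)) x) ∈ u :=
    hρ.tendsto_atTop.eventually (h u hu)
  filter_upwards [h1, heq] with n hn hn'
  rw [hn']
  exact hn

variable {E : Type*} [NormedAddCommGroup E] [NormedSpace ℝ E] [FiniteDimensional ℝ E]
  {F : Type*} [NormedAddCommGroup F] [NormedSpace ℝ F] [FiniteDimensional ℝ F]

omit [FiniteDimensional ℝ E] [FiniteDimensional ℝ F] in
/-- A finite family of orderwise bounds gives one bound for all orders `≤ k + 1`. [folklore] -/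
theorem exists_bound_of_forall_order {U : Set E} {f : ℕ → E → F} (k : ℕ)
    (hb : ∀ (i : ℕ), ∀ K ⊆ U, IsCompact K →
      ∃ Λ : ℝ, ∀ n, ∀ z ∈ K, ‖iteratedFDeriv ℝ i (f n) z‖ ≤ Λ) :
    ∀ K ⊆ U, IsCompact K →
      ∃ Λ : ℝ, ∀ n, ∀ i, i ≤ k + 1 → ∀ z ∈ K, ‖iteratedFDeriv ℝ i (f n) z‖ ≤ Λ := by
  intro K hKU hK
  choose Λ hΛ using fun i ↦ hb i K hKU hK
  refine ⟨(Finset.range (k + 2)).sup' ⟨0, by simp⟩ Λ, fun n i hi z hz ↦ ?_⟩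
  exact (hΛ i n z hz).trans (Finset.le_sup' Λ (by simp; omega))

omit [FiniteDimensional ℝ E] [FiniteDimensional ℝ F] in
/-- Pointwise convergence from uniform convergence of the `0`-th derivatives on a singleton.
[folklore] -/
theorem tendsto_of_tendstoUniformlyOn_iteratedFDeriv_zero {G : ℕ → E → F} {g : E → F} {x : E}
    (h : TendstoUniformlyOn (fun n ↦ iteratedFDeriv ℝ 0 (G n)) (iteratedFDeriv ℝ 0 g) atTop {x}) :
    Tendsto (fun n ↦ G n x) atTop (𝓝 (g x)) := by
  have h1 : Tendsto (fun n ↦ iteratedFDeriv ℝ 0 (G n) x) atTop (𝓝 (iteratedFDeriv ℝ 0 g x)) :=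
    h.tendsto_at (mem_singleton x)
  have h2 : Tendsto (fun n ↦ (iteratedFDeriv ℝ 0 (G n) x) 0) atTop
      (𝓝 ((iteratedFDeriv ℝ 0 g x) 0)) :=
    ((ContinuousMultilinearMap.apply ℝ (fun _ : Fin 0 ↦ E) F 0).continuous.tendsto _).comp h1
  simpa only [iteratedFDeriv_zero_apply] using h2

/-- **The `C^∞` Arzelà–Ascoli theorem** (module docstring): smooth maps on an open set of a
finite-dimensional space, bounded on each compact subset in every `Cⁱ` uniformly in `n`, have a
subsequence converging with all derivatives, uniformly on compact subsets, to a smooth map.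
[cite: Petersen2006, Ch. 10 §3.1] -/
theorem exists_strictMono_contDiffOn_infty_tendstoUniformlyOn_iteratedFDeriv {U : Set E}
    (hU : IsOpen U) {f : ℕ → E → F} (hf : ∀ n, ContDiffOn ℝ ∞ (f n) U)
    (hb : ∀ (i : ℕ), ∀ K ⊆ U, IsCompact K →
      ∃ Λ : ℝ, ∀ n, ∀ z ∈ K, ‖iteratedFDeriv ℝ i (f n) z‖ ≤ Λ) :
    ∃ (g : E → F) (φ : ℕ → ℕ), StrictMono φ ∧ ContDiffOn ℝ ∞ g U ∧
      ∀ (i : ℕ), ∀ K ⊆ U, IsCompact K → TendstoUniformlyOn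
        (fun n ↦ iteratedFDeriv ℝ i (f (φ n))) (iteratedFDeriv ℝ i g) atTop K := by
  classical
  -- the property of a subsequence: `Cᵏ` convergence on compacts to some `Cᵏ` map
  let P : ℕ → (ℕ → ℕ) → Prop := fun k ρ ↦ ∃ g : E → F, ContDiffOn ℝ k g U ∧
    ∀ i, i ≤ k → ∀ K ⊆ U, IsCompact K → TendstoUniformlyOn
      (fun n ↦ iteratedFDeriv ℝ i (f (ρ n))) (iteratedFDeriv ℝ i g) atTop K
  have hsub : ∀ k (ρ ρ' : ℕ → ℕ), (∃ τ : ℕ → ℕ, StrictMono τ ∧ ∀ᶠ m in atTop, ρ' m = ρ (τ m)) →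
      P k ρ → P k ρ' := by
    rintro k ρ ρ' ⟨τ, hτ, heq⟩ ⟨g, hg, hlim⟩
    exact ⟨g, hg, fun i hi K hKU hK ↦ tendstoUniformlyOn_of_eventually_eq_comp
      (G := fun n ↦ iteratedFDeriv ℝ i (f n)) hτ heq (hlim i hi K hKU hK)⟩
  have hex : ∀ k (ρ : ℕ → ℕ), StrictMono ρ → ∃ ψ : ℕ → ℕ, StrictMono ψ ∧ P k (ρ ∘ ψ) := by
    intro k ρ _
    have hf' : ∀ n, ContDiffOn ℝ (k + 1) (f (ρ n)) U := fun n ↦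
      (hf (ρ n)).of_le (by exact_mod_cast le_top)
    obtain ⟨g, ψ, hψ, hg, hlim⟩ :=
      exists_strictMono_contDiffOn_tendstoUniformlyOn_iteratedFDeriv hU hf'
        (exists_bound_of_forall_order (f := fun n ↦ f (ρ n)) k fun i K hKU hK ↦
          (hb i K hKU hK).imp fun Λ hΛ n z hz ↦ hΛ (ρ n) z hz)
    exact ⟨ψ, hψ, g, hg, hlim⟩
  obtain ⟨φ, hφ, hP⟩ := exists_strictMono_forall_of_extraction hsub hex
  choose g hg hlim using hP
  -- all the limits agree on `U`
  have hagree : ∀ k, ∀ x ∈ U, g k x = g 0 x := by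
    intro k x hx
    have hx' : ({x} : Set E) ⊆ U := singleton_subset_iff.2 hx
    have t1 := tendsto_of_tendstoUniformlyOn_iteratedFDeriv_zero
      (hlim k 0 (Nat.zero_le _) {x} hx' isCompact_singleton)
    have t0 := tendsto_of_tendstoUniformlyOn_iteratedFDeriv_zero
      (hlim 0 0 le_rfl {x} hx' isCompact_singleton)
    exact tendsto_nhds_unique t1 t0
  refine ⟨g 0, φ, hφ, ?_, fun i K hKU hK ↦ ?_⟩
  · exact contDiffOn_infty.2 fun k ↦ (hg k).congr fun x hx ↦ (hagree k x hx).symm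
  · have hder : EqOn (iteratedFDeriv ℝ i (g i)) (iteratedFDeriv ℝ i (g 0)) K := fun x hx ↦ by
      refine (Filter.EventuallyEq.iteratedFDeriv ℝ ?_ i).eq_of_nhds
      filter_upwards [hU.mem_nhds (hKU hx)] with y hy
      exact hagree i y hy
    exact (hlim i i le_rfl K hKU hK).congr_right hder

/-- **The `C^∞` Arzelà–Ascoli theorem, locally uniform form.** [cite: Petersen2006, Ch. 10 §3.1] -/
theorem exists_strictMono_contDiffOn_infty_tendstoLocallyUniformlyOn_iteratedFDeriv {U : Set E}
    (hU : IsOpen U) {f : ℕ → E → F} (hf : ∀ n, ContDiffOn ℝ ∞ (f n) U)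
    (hb : ∀ (i : ℕ), ∀ K ⊆ U, IsCompact K →
      ∃ Λ : ℝ, ∀ n, ∀ z ∈ K, ‖iteratedFDeriv ℝ i (f n) z‖ ≤ Λ) :
    ∃ (g : E → F) (φ : ℕ → ℕ), StrictMono φ ∧ ContDiffOn ℝ ∞ g U ∧
      ∀ i : ℕ, TendstoLocallyUniformlyOn
        (fun n ↦ iteratedFDeriv ℝ i (f (φ n))) (iteratedFDeriv ℝ i g) atTop U := by
  obtain ⟨g, φ, hφ, hg, hlim⟩ :=
    exists_strictMono_contDiffOn_infty_tendstoUniformlyOn_iteratedFDeriv hU hf hb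
  exact ⟨g, φ, hφ, hg, fun i ↦ (tendstoLocallyUniformlyOn_iff_forall_isCompact hU).2 (hlim i)⟩

/-- **Eventual uniform smallness of finitely many derivatives** in the situation of the `C^∞`
Arzelà–Ascoli theorem: for every `k`, compact `K ⊆ U` and `ε > 0`, eventually
`‖Dⁱ f_{φ n}(x) − Dⁱ g(x)‖ < ε` for all `i ≤ k`, `x ∈ K` (the `Cᵏ` sup-norm form).
[cite: Petersen2006, Ch. 10 §3.1] -/
theorem exists_strictMono_contDiffOn_infty_eventually_norm_iteratedFDeriv_sub_lt {U : Set E}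
    (hU : IsOpen U) {f : ℕ → E → F} (hf : ∀ n, ContDiffOn ℝ ∞ (f n) U)
    (hb : ∀ (i : ℕ), ∀ K ⊆ U, IsCompact K →
      ∃ Λ : ℝ, ∀ n, ∀ z ∈ K, ‖iteratedFDeriv ℝ i (f n) z‖ ≤ Λ) :
    ∃ (g : E → F) (φ : ℕ → ℕ), StrictMono φ ∧ ContDiffOn ℝ ∞ g U ∧
      ∀ (k : ℕ), ∀ K ⊆ U, IsCompact K → ∀ ε > 0, ∀ᶠ n in atTop, ∀ i, i ≤ k → ∀ x ∈ K,
        ‖iteratedFDeriv ℝ i (f (φ n)) x - iteratedFDeriv ℝ i g x‖ < ε := by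
  obtain ⟨g, φ, hφ, hg, hlim⟩ :=
    exists_strictMono_contDiffOn_infty_tendstoUniformlyOn_iteratedFDeriv hU hf hb
  refine ⟨g, φ, hφ, hg, fun k K hKU hK ε hε ↦ ?_⟩
  have h : ∀ i ∈ Finset.range (k + 1), ∀ᶠ n in atTop, ∀ x ∈ K,
      ‖iteratedFDeriv ℝ i (f (φ n)) x - iteratedFDeriv ℝ i g x‖ < ε := fun i _ ↦ by
    have hu := hlim i K hKU hK
    rw [Metric.tendstoUniformlyOn_iff] at hu
    filter_upwards [hu ε hε] with n hn x hx
    rw [← dist_eq_norm, dist_comm]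
    exact hn x hx
  filter_upwards [(Finset.eventually_all (Finset.range (k + 1))).2 h] with n hn i hi x hx
  exact hn i (Finset.mem_range.2 (Nat.lt_succ_of_le hi)) x hx

end Literature.Analysis.Calculus

end
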